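import Summits.BirchSwinnertonDyer.Rank1Residual.X5.RationalTwoTorsionPoints
import Mathlib.RingTheory.Polynomial.RationalRoot
import HarnessLib

/-!
# Class O1 (X5, `p = 2`): the three CERTIFICATE LEMMAS for the habitat binder
# `TwoAdicSurjective W` — item (21c) of the o1 lead's typer queue v3.4a

HONEST FRAMING (cell `b2b-bsdres`, run/shared/lean/b2b/bsd-rank1-residual/, verbatim in every
file): the goal of the cell is to DELETE the COMBINATION-SHAPED residual classes of the
Birch–Swinnerton-Dyer formula for ALL analytic-rank `≤ 1` elliptic curves over `ℚ` — "full BSD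
formula for every rank `≤ 1` curve in class `C`" assembled STRICTLY from published theorems — so
that the rank-`≤ 1` remainder becomes exactly the CONSTRUCTION-SHAPED classes, which are TYPED
(missing-input `Prop`s), NOT attempted. This is not "finishing BSD". Research routes; no claim
beyond stated classes; census output = EVIDENCE, never a Literature fact; nothing here is booked;
no mark of RESIDUAL-MAP §I moves; O1 stays OPEN.

Unit `b2b-bsdres-cc-typer-4` (lane CLASS-CLOSURE, class O1), gen 5. Theorems only (model-free glue):
no definition, no typed target, no named fact.

After `X5/TwoAdicImageCriteria.lean` (cc-typer-4 gen 4), `X5/TwoAdicImageCriteriaLift.lean` and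
`X5/RationalTwoTorsionPoints.lean` (harvest seat 1 gen 28) the habitat binder `TwoAdicSurjective W`
of R1 / B3 / L3-14 is discharged per curve from ONE named fact (the Dokchitser–Dokchitser criterion
`DokchitserDokchitser2012_surjective_mod_two_four_eight`, PUB) and five per-curve hypotheses:
`Irr W 2`, `Δ, −Δ, 2Δ, −2Δ ∉ ℚ^{×2}`, `j ∉ {−4t³(t + 8) : t ∈ ℚ}`. Each of these is decidable DATA,
but a records module needs them in a shape that `decide` / `norm_num` closes on a literal curve.
This file supplies exactly those shapes (the RECORDS NOTE of `class-closure/O1/TYPING.md` §7 v4.2):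

* (i) **`Irr W 2` ⟸ "the `2`-division cubic has no root modulo `ℓ`"**: a rational point of order
  `2` on `y² + a₁xy + a₃y = x³ + a₂x² + a₄x + a₆` has `2y + a₁x + a₃ = 0`
  (`two_mul_add_eq_zero_of_two_nsmul_eq_zero`), hence `x` is a root of
  `4x³ + b₂x² + 2b₄x + b₆` (`fourCubic_eq_zero_of_two_nsmul_eq_zero`), hence `X = 4x` is a
  RATIONAL root of the MONIC INTEGER cubic `X³ + b₂X² + 8b₄X + 16b₆` (integral model), hence an
  integer (integral root theorem, Mathlib `isInteger_of_is_root_of_monic`), which reduces to a root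
  modulo every `ℓ`. So `∀ r : ZMod ℓ, r³ + b₂r² + 8b₄r + 16b₆ ≠ 0` certifies `Irr W 2`
  (`irr_two_of_forall_cubic_ne`; any modulus `ℓ`, prime or not).
* (ii) **`¬ IsSquare (c : ℚ)` for an integer `c` ⟸ `c < 0`, or "`c` is a non-residue modulo `ℓ`"**
  (`not_isSquare_intCast_of_neg`, `not_isSquare_intCast_of_forall_mul_self_ne`; a rational square
  root of an integer is an integer, Mathlib `Rat.isSquare_intCast_iff`). Since `Δ ≠ 0`, exactly two
  of `Δ, −Δ, 2Δ, −2Δ` are negative, and the other two are `|Δ|, 2|Δ|`: two non-residue certificates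
  suffice (`not_isSquare_four_of_certificates`).
* (iii) **`j ≠ −4t³(t + 8)` for all `t ∈ ℚ` ⟸ "the homogenised quartic `4d·a⁴ + 32d·a³b + n·b⁴`
  (`j = n/d`) has no zero `(a : b) ∈ ℙ¹(ℤ/ℓ)`"** (`forall_ne_quartic_of_forall_ne`; `t = a/b` in
  lowest terms gives a primitive integer zero, which stays non-zero modulo any `ℓ > 1`).

Assembly: **`twoAdicSurjective_of_certificates`** — `TwoAdicSurjective W` from the DD fact, the six
integers `b₂, b₄, b₆, Δ, n, d` of the model (each a `norm_num` evaluation on a literal curve) and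
four `decide`-shaped certificates. A certificate modulus always EXISTS when the hypothesis it
certifies is true (Chebotarev: an irreducible cubic has no root mod a positive density of primes; a
non-square is a non-residue mod half the primes; a rational quartic form without rational zero has
no zero mod infinitely many primes — every transitive subgroup of `S₄`, and the Klein/biquadratic
reducible case, contains a derangement), but existence is NOT claimed in the kernel: the records
supply the modulus. Worked instance (not shipped as data of record): `1309a1 = [0,0,1,−406957,−99924251]`
(O1-B, `surj8 = 1` in the typer anatomy / lens-4 ANATOMY2 / lead D22) certifies with
`ℓ = 3` (cubic), `3` (`|Δ|`), `5` (`2|Δ|`), `13` (quartic).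

References: [DokchitserDokchitserMathZ2012] Theorem (p. 961); [RouseZureickbrown2015] §1, §3 Lemma;
Silverman *AEC* III.2.3 (negation / `2`-torsion), VIII.7 exercises (division polynomial `ψ₂`).
-/

set_option autoImplicit false

noncomputable section

open scoped Classical

open WeierstrassCurve Polynomial Literature.NumberTheory.EllipticCurves
  Literature.NumberTheory.EllipticCurves.Rank1Residual

namespace Summit.BirchSwinnertonDyer.Rank1Residual.X5.O1

/-! ## §1 Arithmetic certificates (no curve) -/

/-- A rational root of a monic integer cubic is an integer (integral root theorem over the UFD `ℤ`).
[folklore] -/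
theorem exists_intCast_eq_of_cubic_eq_zero {c₂ c₁ c₀ : ℤ} {q : ℚ}
    (hq : q ^ 3 + c₂ * q ^ 2 + c₁ * q + c₀ = 0) : ∃ m : ℤ, (m : ℚ) = q := by
  set p : ℤ[X] := X ^ 3 + C c₂ * X ^ 2 + C c₁ * X + C c₀ with hp_def
  have hp : p.Monic := by
    rw [hp_def]
    monicity!
  have hr : aeval q p = 0 := by
    simpa [hp_def] using hq
  obtain ⟨m, hm⟩ := isInteger_of_is_root_of_monic hp hr
  exact ⟨m, by simpa using hm⟩

/-- **Certificate (i), arithmetic core**: if the monic integer cubic `X³ + c₂X² + c₁X + c₀` has no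
root modulo `ℓ`, it has no rational root. [folklore] -/
theorem forall_cubic_ne_zero_of_forall_ne {c₂ c₁ c₀ : ℤ} {ℓ : ℕ}
    (h : ∀ r : ZMod ℓ, r ^ 3 + (c₂ : ZMod ℓ) * r ^ 2 + (c₁ : ZMod ℓ) * r + (c₀ : ZMod ℓ) ≠ 0)
    (q : ℚ) : q ^ 3 + c₂ * q ^ 2 + c₁ * q + c₀ ≠ 0 := by
  intro hq
  obtain ⟨m, rfl⟩ := exists_intCast_eq_of_cubic_eq_zero hq
  have hm : (m : ℤ) ^ 3 + c₂ * m ^ 2 + c₁ * m + c₀ = 0 := by exact_mod_cast hq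
  refine h (m : ZMod ℓ) ?_
  have := congrArg (Int.cast : ℤ → ZMod ℓ) hm
  push_cast at this
  exact this

/-- **Certificate (ii), sign**: a negative integer is not a square in `ℚ`. [folklore] -/
theorem not_isSquare_intCast_of_neg {c : ℤ} (hc : c < 0) : ¬ IsSquare (c : ℚ) := by
  rintro ⟨r, hr⟩
  have h0 : (0 : ℚ) ≤ r * r := mul_self_nonneg r
  rw [← hr] at h0
  exact absurd (by exact_mod_cast h0 : (0 : ℤ) ≤ c) (not_le.mpr hc)

/-- **Certificate (ii), residue**: an integer which is not a square modulo `ℓ` is not a square in `ℚ`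
(a rational square root of an integer is an integer). [folklore] -/
theorem not_isSquare_intCast_of_forall_mul_self_ne {c : ℤ} {ℓ : ℕ}
    (h : ∀ r : ZMod ℓ, r * r ≠ (c : ZMod ℓ)) : ¬ IsSquare (c : ℚ) := by
  intro hc
  obtain ⟨m, hm⟩ := Rat.isSquare_intCast_iff.mp hc
  refine h (m : ZMod ℓ) ?_
  have := congrArg (Int.cast : ℤ → ZMod ℓ) hm
  push_cast at this
  exact this.symm

/-- **Certificate (iii), arithmetic core**: if the binary quartic form `4d·a⁴ + 32d·a³b + n·b⁴` has
no zero `(a, b) ≠ (0, 0)` modulo some `ℓ > 1`, then `n/d ≠ −4t³(t + 8)` for every rational `t`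
(write `t = a/b` in lowest terms: `n·b⁴ = −4d·a³(a + 8b)` is a primitive integer zero). [folklore] -/
theorem forall_ne_quartic_of_forall_ne {n d : ℤ} (hd : d ≠ 0) {ℓ : ℕ} (hℓ : 1 < ℓ)
    (h : ∀ a b : ZMod ℓ, (a ≠ 0 ∨ b ≠ 0) →
      4 * (d : ZMod ℓ) * a ^ 4 + 32 * (d : ZMod ℓ) * a ^ 3 * b + (n : ZMod ℓ) * b ^ 4 ≠ 0)
    (t : ℚ) : (n : ℚ) / d ≠ -4 * t ^ 3 * (t + 8) := by
  intro ht
  -- `t = a / b` in lowest terms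
  set a : ℤ := t.num with ha
  set b : ℕ := t.den with hb
  have hb0 : (b : ℚ) ≠ 0 := by exact_mod_cast t.den_nz
  have htab : t = a / b := (Rat.num_div_den t).symm
  have hdQ : (d : ℚ) ≠ 0 := by exact_mod_cast hd
  -- the primitive integer zero
  have h0 : 4 * t ^ 3 * (t + 8) + (n : ℚ) / d = 0 := by linear_combination ht
  have key : 4 * (d : ℚ) * (a : ℚ) ^ 4 + 32 * (d : ℚ) * (a : ℚ) ^ 3 * (b : ℚ) + (n : ℚ) * (b : ℚ) ^ 4
      = ((d : ℚ) * (b : ℚ) ^ 4) * (4 * t ^ 3 * (t + 8) + (n : ℚ) / d) := by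
    rw [htab]
    field_simp
    ring
  have hQ : 4 * (d : ℚ) * (a : ℚ) ^ 4 + 32 * (d : ℚ) * (a : ℚ) ^ 3 * (b : ℚ) + (n : ℚ) * (b : ℚ) ^ 4
      = 0 := by
    rw [key, h0, mul_zero]
  have hZ : 4 * d * a ^ 4 + 32 * d * a ^ 3 * (b : ℤ) + n * (b : ℤ) ^ 4 = 0 := by
    exact_mod_cast hQ
  -- reduce modulo `ℓ`
  refine h (a : ZMod ℓ) (b : ZMod ℓ) ?_ ?_
  · by_contra hab
    rw [not_or, not_not, not_not] at hab
    obtain ⟨ha0, hb0'⟩ := hab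
    have hℓa : ℓ ∣ a.natAbs := Int.natCast_dvd.mp ((ZMod.intCast_zmod_eq_zero_iff_dvd a ℓ).mp ha0)
    have hℓb : ℓ ∣ b := (ZMod.natCast_eq_zero_iff b ℓ).mp hb0'
    have hℓ1 : ℓ = 1 := Nat.eq_one_of_dvd_coprimes t.reduced hℓa hℓb
    omega
  · have := congrArg (Int.cast : ℤ → ZMod ℓ) hZ
    push_cast at this
    exact this

/-! ## §2 The `2`-division cubic of a Weierstrass curve -/

variable (W : WeierstrassCurve ℚ) [W.IsElliptic]

omit [W.IsElliptic] in
/-- A rational affine point `(x, y)` with `2·(x, y) = O` satisfies `2y + a₁x + a₃ = 0` (it equals its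
negative `(x, −y − a₁x − a₃)`; Silverman *AEC* III.2.3). [folklore] -/
theorem two_mul_add_eq_zero_of_two_nsmul_eq_zero {x y : ℚ} {h : W.toAffine.Nonsingular x y}
    (h2 : (2 : ℕ) • (Affine.Point.some x y h) = 0) : 2 * y + W.a₁ * x + W.a₃ = 0 := by
  rw [two_nsmul, add_eq_zero_iff_eq_neg, Affine.Point.neg_some, Affine.Point.some.injEq] at h2
  have hy := h2.2
  simp only [Affine.negY] at hy
  linear_combination hy

omit [W.IsElliptic] in
/-- The `x`-coordinate of a rational point of order dividing `2` is a root of the `2`-division cubic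
`4x³ + b₂x² + 2b₄x + b₆` (`(2y + a₁x + a₃)² = 4x³ + b₂x² + 2b₄x + b₆` on the curve). [folklore] -/
theorem fourCubic_eq_zero_of_two_nsmul_eq_zero {x y : ℚ} {h : W.toAffine.Nonsingular x y}
    (h2 : (2 : ℕ) • (Affine.Point.some x y h) = 0) :
    4 * x ^ 3 + W.b₂ * x ^ 2 + 2 * W.b₄ * x + W.b₆ = 0 := by
  have hy := two_mul_add_eq_zero_of_two_nsmul_eq_zero W h2
  have heq : y ^ 2 + W.a₁ * x * y + W.a₃ * y = x ^ 3 + W.a₂ * x ^ 2 + W.a₄ * x + W.a₆ :=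
    (Affine.equation_iff x y).mp h.1
  simp only [WeierstrassCurve.b₂, WeierstrassCurve.b₄, WeierstrassCurve.b₆]
  linear_combination (-4 : ℚ) * heq + (2 * y + W.a₁ * x + W.a₃) * hy

omit [W.IsElliptic] in
/-- The monic rescaling: `X = 4x` is a root of `X³ + b₂X² + 8b₄X + 16b₆`. [folklore] -/
theorem monicCubic_eq_zero_of_two_nsmul_eq_zero {x y : ℚ} {h : W.toAffine.Nonsingular x y}
    (h2 : (2 : ℕ) • (Affine.Point.some x y h) = 0) :
    (4 * x) ^ 3 + W.b₂ * (4 * x) ^ 2 + 8 * W.b₄ * (4 * x) + 16 * W.b₆ = 0 := by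
  linear_combination (16 : ℚ) * fourCubic_eq_zero_of_two_nsmul_eq_zero W h2

/-- **Certificate lemma (i)**: on a model with integral `b₂, b₄, b₆` (e.g. a minimal model), if the
monic integer cubic `X³ + b₂X² + 8b₄X + 16b₆` has no root modulo `ℓ` then `E(ℚ)` has no point of
order `2`, i.e. `Irr W 2` (`E[2]` is an irreducible `Γ_ℚ`-module). Any modulus `ℓ`; per curve the
hypothesis is closed by `decide`. [folklore] -/
theorem irr_two_of_forall_cubic_ne {B₂ B₄ B₆ : ℤ} (hb₂ : W.b₂ = B₂) (hb₄ : W.b₄ = B₄)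
    (hb₆ : W.b₆ = B₆) {ℓ : ℕ}
    (h : ∀ r : ZMod ℓ,
      r ^ 3 + (B₂ : ZMod ℓ) * r ^ 2 + ((8 * B₄ : ℤ) : ZMod ℓ) * r + ((16 * B₆ : ℤ) : ZMod ℓ) ≠ 0) :
    Irr W 2 := by
  rw [irr_two_iff_forall_two_nsmul]
  rintro (_ | ⟨x, y, hxy⟩) h2
  · rfl
  · exfalso
    have hX := monicCubic_eq_zero_of_two_nsmul_eq_zero W h2
    rw [hb₂, hb₄, hb₆] at hX
    refine forall_cubic_ne_zero_of_forall_ne h (4 * x) ?_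
    push_cast
    linear_combination hX

/-! ## §3 The discriminant conditions -/

omit [W.IsElliptic] in
/-- **Certificate lemma (ii)**: with `Δ = D ∈ ℤ ∖ {0}`, non-residue certificates for `|D|` and `2|D|`
give all four Dokchitser–Dokchitser conditions `Δ, −Δ, 2Δ, −2Δ ∉ ℚ^{×2}` (the two of the other sign
are negative). [folklore] -/
theorem not_isSquare_four_of_certificates {D : ℤ} (hΔ : W.Δ = D) (hD : D ≠ 0) {ℓ₂ ℓ₃ : ℕ}
    (h₂ : ∀ r : ZMod ℓ₂, r * r ≠ ((|D| : ℤ) : ZMod ℓ₂))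
    (h₃ : ∀ r : ZMod ℓ₃, r * r ≠ ((2 * |D| : ℤ) : ZMod ℓ₃)) :
    ¬ IsSquare W.Δ ∧ ¬ IsSquare (-W.Δ) ∧ ¬ IsSquare (2 * W.Δ) ∧ ¬ IsSquare (-2 * W.Δ) := by
  have hA := not_isSquare_intCast_of_forall_mul_self_ne h₂
  have hB := not_isSquare_intCast_of_forall_mul_self_ne h₃
  rw [hΔ]
  rcases lt_or_gt_of_ne hD with hneg | hpos
  · rw [abs_of_neg hneg] at hA hB
    have h2 : (2 * D : ℤ) < 0 := by linarith
    refine ⟨not_isSquare_intCast_of_neg hneg, ?_, ?_, ?_⟩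
    · convert hA using 2; push_cast; ring
    · convert not_isSquare_intCast_of_neg h2 using 2; push_cast; ring
    · convert hB using 2; push_cast; ring
  · rw [abs_of_pos hpos] at hA hB
    have h1 : (-D : ℤ) < 0 := by linarith
    have h2 : (-2 * D : ℤ) < 0 := by linarith
    refine ⟨hA, ?_, ?_, ?_⟩
    · convert not_isSquare_intCast_of_neg h1 using 2; push_cast; ring
    · convert hB using 2; push_cast; ring
    · convert not_isSquare_intCast_of_neg h2 using 2; push_cast; ring

/-! ## §4 The `j`-condition and the assembly -/

/-- **Certificate lemma (iii)**: with `j = n/d` (`d ≠ 0`), if the form `4d·a⁴ + 32d·a³b + n·b⁴` has no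
non-trivial zero modulo some `ℓ > 1`, then `j ≠ −4t³(t + 8)` for every `t ∈ ℚ`. [folklore] -/
theorem forall_j_ne_of_forall_ne {n d : ℤ} (hd : d ≠ 0) (hj : W.j = n / d) {ℓ : ℕ} (hℓ : 1 < ℓ)
    (h : ∀ a b : ZMod ℓ, (a ≠ 0 ∨ b ≠ 0) →
      4 * (d : ZMod ℓ) * a ^ 4 + 32 * (d : ZMod ℓ) * a ^ 3 * b + (n : ZMod ℓ) * b ^ 4 ≠ 0) :
    ∀ t : ℚ, W.j ≠ -4 * t ^ 3 * (t + 8) := by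
  intro t
  rw [hj]
  exact forall_ne_quartic_of_forall_ne hd hℓ h t

/-- **The habitat binder from PRINT by CERTIFICATE** (PROVED modulo the one named fact
`DokchitserDokchitser2012_surjective_mod_two_four_eight`): on a model with integral `b₂, b₄, b₆` and
`Δ = D`, `j = n/d`, the four `decide`-shaped certificates — no root of `X³ + b₂X² + 8b₄X + 16b₆`
mod `ℓ₁`; `|D|` a non-residue mod `ℓ₂`; `2|D|` a non-residue mod `ℓ₃`; no zero of
`4d·a⁴ + 32d·a³b + n·b⁴` on `ℙ¹(ℤ/ℓ₄)`, `ℓ₄ > 1` — give `TwoAdicSurjective W`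
(`ρ_{E,2^∞}` onto `GL₂(ℤ₂)`). This is the records-module entry point for the habitat of R1 / B3 /
L3-14; nothing is booked by it. [cite: DokchitserDokchitserMathZ2012, Theorem (p. 961)]
[cite: RouseZureickbrown2015, §3 Lemma and §1] -/
theorem twoAdicSurjective_of_certificates
    (hDD : DokchitserDokchitser2012_surjective_mod_two_four_eight)
    {B₂ B₄ B₆ D n d : ℤ} (hb₂ : W.b₂ = B₂) (hb₄ : W.b₄ = B₄) (hb₆ : W.b₆ = B₆) (hΔ : W.Δ = D)
    (hd : d ≠ 0) (hj : W.j = n / d) {ℓ₁ ℓ₂ ℓ₃ ℓ₄ : ℕ} (hℓ₄ : 1 < ℓ₄)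
    (h₁ : ∀ r : ZMod ℓ₁,
      r ^ 3 + (B₂ : ZMod ℓ₁) * r ^ 2 + ((8 * B₄ : ℤ) : ZMod ℓ₁) * r + ((16 * B₆ : ℤ) : ZMod ℓ₁) ≠ 0)
    (h₂ : ∀ r : ZMod ℓ₂, r * r ≠ ((|D| : ℤ) : ZMod ℓ₂))
    (h₃ : ∀ r : ZMod ℓ₃, r * r ≠ ((2 * |D| : ℤ) : ZMod ℓ₃))
    (h₄ : ∀ a b : ZMod ℓ₄, (a ≠ 0 ∨ b ≠ 0) →
      4 * (d : ZMod ℓ₄) * a ^ 4 + 32 * (d : ZMod ℓ₄) * a ^ 3 * b + (n : ZMod ℓ₄) * b ^ 4 ≠ 0) :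
    TwoAdicSurjective W := by
  have hD : D ≠ 0 := by
    have := W.isUnit_Δ.ne_zero
    rw [hΔ] at this
    exact_mod_cast this
  obtain ⟨hΔ₀, hΔ₁, hΔ₂, hΔ₃⟩ := not_isSquare_four_of_certificates W hΔ hD h₂ h₃
  exact twoAdicSurjective_of_dokchitser_of_irr W hDD (irr_two_of_forall_cubic_ne W hb₂ hb₄ hb₆ h₁)
    hΔ₀ hΔ₁ hΔ₂ hΔ₃ (forall_j_ne_of_forall_ne W hd hj hℓ₄ h₄)

/-! ## §5 Worked instance (instrumentation, not a record of the cell): `1309a1` -/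

/-- `1309a1 = [0, 0, 1, −406957, −99924251]` (O1-B, good supersingular at `2`, `S₃` image, `surj8 = 1`
in the anatomy of record) — its `2`-adic image is all of `GL₂(ℤ₂)`, modulo the DD fact, by the
certificates `ℓ = 3, 3, 5, 13`. Instrumentation for the records author; nothing booked. [folklore] -/
example (hDD : DokchitserDokchitser2012_surjective_mod_two_four_eight) :
    TwoAdicSurjective (⟨0, 0, 1, -406957, -99924251⟩ : WeierstrassCurve ℚ) := by
  haveI : (⟨0, 0, 1, -406957, -99924251⟩ : WeierstrassCurve ℚ).IsElliptic :=
    ⟨by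
      rw [isUnit_iff_ne_zero]
      norm_num [WeierstrassCurve.Δ, WeierstrassCurve.b₂, WeierstrassCurve.b₄, WeierstrassCurve.b₆,
        WeierstrassCurve.b₈]⟩
  refine twoAdicSurjective_of_certificates _ hDD (B₂ := 0) (B₄ := -813914) (B₆ := -399697003)
    (D := -45254746691) (n := -7453654902730081529856) (d := 45254746691)
    (ℓ₁ := 3) (ℓ₂ := 3) (ℓ₃ := 5) (ℓ₄ := 13) ?_ ?_ ?_ ?_ (by norm_num) ?_ (by norm_num) ?_ ?_ ?_ ?_
  · norm_num [WeierstrassCurve.b₂]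
  · norm_num [WeierstrassCurve.b₄]
  · norm_num [WeierstrassCurve.b₆]
  · norm_num [WeierstrassCurve.Δ, WeierstrassCurve.b₂, WeierstrassCurve.b₄, WeierstrassCurve.b₆,
      WeierstrassCurve.b₈]
  · rw [WeierstrassCurve.j, Units.val_inv_eq_inv_val, WeierstrassCurve.coe_Δ']
    norm_num [WeierstrassCurve.c₄, WeierstrassCurve.Δ, WeierstrassCurve.b₂, WeierstrassCurve.b₄,
      WeierstrassCurve.b₆, WeierstrassCurve.b₈]
  · decide
  · decide
  · decide
  · decide

end Summit.BirchSwinnertonDyer.Rank1Residual.X5.O1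

end
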